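import Summits.ValiantsHypothesis.ValiantsHypothesis.Theorems.BarrierLeverChowThinRowsSubcubeBasis

/-!
# Route BarrierLever — item `ChowHitsThinRowPartitionMinors` (stmt-ValiantsHypothesis-20195):
# the FIRST-ORDER-ROWS slice on every small DOWN-CLOSED column family (sub-cubes, simplicial
# complexes) holds at EVERY height, by one explicit product

Helper file (`--supports stmt-ValiantsHypothesis-20195`; cell valiant-natproofs, rung V4, 𝒟-side of
door (c); prover seat valiant-natproofs-prover gen 10).  Closes NO item; imports only
`…ChowThinRowsSubcubeBasis` (hence only seat val-np-p4's infrastructure; no route file).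

Conventions of items 19717 / 20172 / 20195: `x_a = X (castAdd h a)`, `y_c = X (natAdd h c)` in
`MvPolynomial (Fin (h+h)) ℂ`; the partition-matrix entry of `f` at the layout position `(u, w)` is
`coeff (E u w) f`, `E u w = Σ_{a ∈ u} single (castAdd h a) 1 + Σ_{c ∈ w} single (natAdd h c) 1`.

**Master theorem `chowHits_firstOrderRows_of_downClosed`.** For every height `h`, every DOWN-CLOSED
family `𝒟` of subsets of `Fin h` with `|𝒟| ≤ h + h`, and every layout with injective rows `u i` of
size `≤ 1` and injective columns `w j ∈ 𝒟` (any `r`), there is a product `∏_k ℓ_k` of `h + h` affine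
forms whose partition minor `det[coeff (E (u i) (w j)) ∏ ℓ]` is nonzero (item 20195's conclusion
verbatim on that slice).  Corollaries: `chowHits_firstOrderRows_subcubeColumns` (`𝒟 = 2^T`,
`2^{|T|} ≤ h + h`: columns inside a cube of dimension `≤ log₂(2h)` — the slice containing EVERY
capacity counterexample to the refuted universal-witness conjecture TNS, rows `∅` + singletons ×
all of `2^T`, `2^{|T|} = h + 1`; so products of affine forms pass, in the kernel and for all `h`, the
test that killed TNS / TT / CT / PP / GP / hub / chain / UT-D / SCK) and
`chowHits_firstOrderRows_downClosedColumns` (`𝒟 =` the columns themselves when they form a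
simplicial complex, `h ≥ 1`; no size restriction), `chowHits_firstOrderRows_smallShadow` (any
columns whose down-closure has `≤ h + h` sets).

**The witness** (explicit): the INDICATOR FORMS `φ_V = 1 + Σ_{c ∈ V} y_c + Σ_a κ_a(V) x_a`, `V ∈ 𝒟`,
padded with constant forms `1`.  Mechanism (`E_V :=` the product of the `y`-parts of all forms but
`φ_V`, `B :=` the full product; prelims in `…SubcubePrelims` / `…SubcubeBasis`):
* `coeff_leaveOneOut`: on squarefree monomials `E_V = B · t_V` with the TRUNCATED INVERSE
  `t_V = Σ_{U ⊆ V} (-1)^{|U|} |U|! y^U` (`coeff_tinv_mul_form0`: `t_V · φ⁰_V ≡ 1`);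
* `leaveOneOut_independent_of_downClosed`: the `t_V` are triangular in the containment order and
  `B(∅) = 1`; down-closedness keeps both triangular systems inside `𝒟`, so the vectors
  `(coeff_{y^W} E_V)_{W ∈ 𝒟}`, `V ∈ 𝒟`, are a BASIS of `ℂ^𝒟` (a planted, genericity-free instance
  of the «SPARK / leave-one-out MDS» lemma of planner g14's MEMO-thinrows §10);
* `coeff_single_prod` (derivative formula): the singleton row `{a}` of the partition matrix is
  `Σ_V κ_a(V) · (row of E_V)`, so the `x`-coefficients `κ` are SOLVED (`Matrix.vecMul_surjective_iff_isUnit`)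
  to make row `{a_i}` the indicator of its own column `w i`; the `∅`-row is `B`, whose coefficients
  are positive integers (`coeff_empty_prod_nat`), and the minor is the identity with one row
  replaced — determinant `B(w i₀) ≥ 1` (`det_one_updateRow`).

WHAT THIS IS NOT: rows of size `2` are not treated (the pair layer of item 20195 is the polarised
second-order object `Σ_{k≠k'} u_{ka} u_{k'b} E_{kk'}`, not free in `κ`); column families whose
down-closure has more than `h + h` sets need the genericity form of the leave-one-out lemma
(SPARK); nothing on items 20172 / 19717 in general, on crux stmt-ValiantsHypothesis-14610, or on
`VP` versus `VNP`.

References: [ForbesShpilkaVolk2018] §8 (partition-matrix / read-once distinguishers); Nisan 1991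
(partition matrices); planner valiant-natproofs-p1 g14, MEMO-thinrows-proofplan.md §1d/§10 (s = 1
layer, SPARK); val-np-p3 g4 STATUS 2026-08-27T05:15:56Z (inverse products in `ℂ[y_T]/(y_c²)`).
-/

set_option linter.dupNamespace false

namespace Summit.ValiantsHypothesis.ValiantsHypothesis.Theorems.BarrierLever.ChowSubcube

open Finset MvPolynomial
open Summit.ValiantsHypothesis.ValiantsHypothesis.Theorems.BarrierLever.ChowFactor
  (coeff_partitionExpo_mul_affine coeff_partitionExpo_mul_yOnly totalDegree_affine_le)
open Summit.ValiantsHypothesis.ValiantsHypothesis.Theorems.BarrierLever.ProductStateSums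
  (castAdd_ne_natAdd partitionExpo_apply_castAdd partitionExpo_apply_natAdd)
open Summit.ValiantsHypothesis.ValiantsHypothesis.Theorems.BarrierLever.CorankRepair (partitionExpo_eq_iff)

variable {h : ℕ}

/-! ## Independence over a down-closed family -/

/-- **Linear independence of the leave-one-out products over a DOWN-CLOSED family** `𝒟` of
subsets (generalising `leaveOneOut_independent`, the case `𝒟 = 2^T`): the products
`E_V = ∏_{V' ∈ 𝒟, V' ≠ V} φ⁰_{V'}`, `V ∈ 𝒟`, have linearly independent coefficient vectors on the
squarefree monomials `y^W`, `W ∈ 𝒟`.  Same mechanism: `E_V = B · t_V`, `t_V` triangular, `B(∅) = 1`;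
down-closedness is exactly what keeps both triangular systems inside `𝒟`. -/
theorem leaveOneOut_independent_of_downClosed (DD : Finset (Finset (Fin h)))
    (hDD : ∀ W ∈ DD, ∀ U : Finset (Fin h), U ⊆ W → U ∈ DD) (cV : Finset (Fin h) → ℂ)
    (hc : ∀ W ∈ DD, ∑ V ∈ DD, cV V *
      coeff (∑ a ∈ (∅ : Finset (Fin h)), Finsupp.single (Fin.castAdd h a) 1 +
          ∑ c ∈ W, Finsupp.single (Fin.natAdd h c) 1)
        (∏ V' ∈ DD.erase V, (C 1 + ∑ a, C ((fun (_ : Fin h) (_ : Finset (Fin h)) => (0 : ℂ)) a V') *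
          X (Fin.castAdd h a) + ∑ c, C (if c ∈ V' then (1 : ℂ) else 0) * X (Fin.natAdd h c))) = 0) :
    ∀ V ∈ DD, cV V = 0 := by
  classical
  set B : MvPolynomial (Fin (h + h)) ℂ := ∏ V' ∈ DD,
    (C 1 + ∑ a, C ((fun (_ : Fin h) (_ : Finset (Fin h)) => (0 : ℂ)) a V') * X (Fin.castAdd h a) +
      ∑ c, C (if c ∈ V' then (1 : ℂ) else 0) * X (Fin.natAdd h c)) with hB
  set b : Finset (Fin h) → ℂ := fun X' => coeff (∑ a ∈ (∅ : Finset (Fin h)),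
    Finsupp.single (Fin.castAdd h a) 1 + ∑ c ∈ X', Finsupp.single (Fin.natAdd h c) 1) B with hb
  set d : Finset (Fin h) → ℂ := fun U => ((-1 : ℂ) ^ U.card * (U.card.factorial : ℂ)) *
    ∑ V ∈ DD with U ⊆ V, cV V with hd
  have hb0 : b ∅ = 1 := by
    simp only [hb, hB]
    exact coeff_empty_empty_prod _ _
  have hconv : ∀ W ∈ DD, ∑ U ∈ W.powerset, b (W \ U) * d U = 0 := by
    intro W hW
    have e := hc W hW
    have hrow : ∀ V ∈ DD, cV V *
        coeff (∑ a ∈ (∅ : Finset (Fin h)), Finsupp.single (Fin.castAdd h a) 1 +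
            ∑ c ∈ W, Finsupp.single (Fin.natAdd h c) 1)
          (∏ V' ∈ DD.erase V, (C 1 + ∑ a, C ((fun (_ : Fin h) (_ : Finset (Fin h)) => (0 : ℂ)) a V') *
            X (Fin.castAdd h a) + ∑ c, C (if c ∈ V' then (1 : ℂ) else 0) * X (Fin.natAdd h c))) =
        ∑ U ∈ W.powerset, cV V * (b (W \ U) *
          if U ⊆ V then (-1 : ℂ) ^ U.card * (U.card.factorial : ℂ) else 0) := by
      intro V hV
      rw [coeff_leaveOneOut _ V hV W, Finset.mul_sum]
      refine Finset.sum_congr rfl fun U _ => ?_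
      rw [coeff_tinv]
    rw [Finset.sum_congr rfl hrow, Finset.sum_comm] at e
    rw [← e]
    refine Finset.sum_congr rfl fun U _ => ?_
    simp only [hd, Finset.sum_filter, Finset.mul_sum]
    refine Finset.sum_congr rfl fun V _ => ?_
    split_ifs <;> ring
  have hA : ∀ n : ℕ, ∀ W ∈ DD, W.card = n → d W = 0 := by
    intro n
    induction n using Nat.strong_induction_on with
    | _ n ih =>
      intro W hW hWn
      have e := hconv W hW
      rw [← Finset.add_sum_erase _ _ (Finset.mem_powerset_self W), Finset.sdiff_self, hb0,
        one_mul] at e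
      have hrest : ∑ U ∈ W.powerset.erase W, b (W \ U) * d U = 0 := by
        refine Finset.sum_eq_zero fun U hU => ?_
        rw [Finset.mem_erase, Finset.mem_powerset] at hU
        have hUT : U ∈ DD := hDD W hW U hU.2
        have hlt : U.card < n := hWn ▸ Finset.card_lt_card (lt_of_le_of_ne hU.2 hU.1)
        rw [ih U.card hlt U hUT rfl, mul_zero]
      rwa [hrest, add_zero] at e
  have hB' : ∀ n : ℕ, ∀ V ∈ DD, h - V.card = n → cV V = 0 := by
    intro n
    induction n using Nat.strong_induction_on with
    | _ n ih =>
      intro V hV hVn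
      have hdV : d V = 0 := hA V.card V hV rfl
      have hs : ((-1 : ℂ) ^ V.card * (V.card.factorial : ℂ)) ≠ 0 :=
        mul_ne_zero (pow_ne_zero _ (by norm_num)) (by exact_mod_cast V.card.factorial_ne_zero)
      have hsum : ∑ V' ∈ DD with V ⊆ V', cV V' = 0 := by
        simpa [hd, hs] using hdV
      have hVmem : V ∈ DD.filter (fun V' => V ⊆ V') :=
        Finset.mem_filter.mpr ⟨hV, subset_refl V⟩
      rw [← Finset.add_sum_erase _ _ hVmem] at hsum
      have hrest : ∑ V' ∈ (DD.filter (fun V' => V ⊆ V')).erase V, cV V' = 0 := by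
        refine Finset.sum_eq_zero fun V' hV' => ?_
        rw [Finset.mem_erase, Finset.mem_filter] at hV'
        have hlt' : V.card < V'.card :=
          Finset.card_lt_card (lt_of_le_of_ne hV'.2.2 (Ne.symm hV'.1))
        have hle : V'.card ≤ h := by
          simpa using Finset.card_le_univ V'
        exact ih (h - V'.card) (by omega) V' hV'.2.1 rfl
      rwa [hrest, add_zero] at hsum
  intro V hV
  exact hB' _ V hV rfl


/-! ## The slice theorems -/

/-- **MASTER THEOREM — thin-row CPM on first-order rows × columns inside a small down-closed
family, every height** (item `ChowHitsThinRowPartitionMinors`, stmt-ValiantsHypothesis-20195,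
restricted to rows of size `≤ 1` and columns taken from a down-closed family `𝒟` of at most `h + h`
sets): ONE explicit product of `h + h` affine forms — the indicator forms
`1 + Σ_{c ∈ V} y_c + Σ_a κ_a(V) x_a`, `V ∈ 𝒟`, padded with constants — makes the partition minor
nonsingular. -/
theorem chowHits_firstOrderRows_of_downClosed (h : ℕ) (DD : Finset (Finset (Fin h)))
    (hDD : ∀ W ∈ DD, ∀ U : Finset (Fin h), U ⊆ W → U ∈ DD) (hcard : DD.card ≤ h + h)
    (r : ℕ) (u w : Fin r → Finset (Fin h))
    (hu : Function.Injective u) (hw : Function.Injective w)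
    (hu1 : ∀ i, (u i).card ≤ 1) (hwT : ∀ j, w j ∈ DD) :
    ∃ ℓ : Fin (h + h) → MvPolynomial (Fin (h + h)) ℂ, (∀ k, (ℓ k).totalDegree ≤ 1) ∧
      (Matrix.of fun i j : Fin r => MvPolynomial.coeff
        (∑ a ∈ u i, Finsupp.single (Fin.castAdd h a) 1 +
          ∑ c ∈ w j, Finsupp.single (Fin.natAdd h c) 1) (∏ k, ℓ k)).det ≠ 0 := by
  classical
  -- the leave-one-out matrix of the `y`-parts, indexed by the subtype of `DD`
  set PT : Finset (Finset (Fin h)) := DD with hPT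
  have hwP : ∀ j, w j ∈ PT := fun j => hwT j
  set ℰ : Matrix PT PT ℂ := Matrix.of fun V W =>
    coeff (∑ a ∈ (∅ : Finset (Fin h)), Finsupp.single (Fin.castAdd h a) 1 +
        ∑ c ∈ (W : Finset (Fin h)), Finsupp.single (Fin.natAdd h c) 1)
      (∏ V' ∈ PT.erase (V : Finset (Fin h)),
        (C 1 + ∑ a, C ((fun (_ : Fin h) (_ : Finset (Fin h)) => (0 : ℂ)) a V') * X (Fin.castAdd h a) +
          ∑ c, C (if c ∈ V' then (1 : ℂ) else 0) * X (Fin.natAdd h c))) with hℰ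
  -- Step 1: `vecMul` by `ℰ` is injective (linear independence of the leave-one-out products)
  have hinj : Function.Injective ℰ.vecMul := by
    intro c₁ c₂ hc
    rw [← sub_eq_zero]
    have h0 : Matrix.vecMul (c₁ - c₂) ℰ = 0 := by
      rw [Matrix.sub_vecMul]
      exact sub_eq_zero.mpr hc
    set c := c₁ - c₂ with hcdef
    let cV : Finset (Fin h) → ℂ := fun V => if hV : V ∈ PT then c ⟨V, hV⟩ else 0
    have hcV : ∀ W ∈ PT, ∑ V ∈ PT, cV V *
        coeff (∑ a ∈ (∅ : Finset (Fin h)), Finsupp.single (Fin.castAdd h a) 1 +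
            ∑ c ∈ W, Finsupp.single (Fin.natAdd h c) 1)
          (∏ V' ∈ PT.erase V, (C 1 + ∑ a, C ((fun (_ : Fin h) (_ : Finset (Fin h)) => (0 : ℂ)) a V') *
            X (Fin.castAdd h a) + ∑ c, C (if c ∈ V' then (1 : ℂ) else 0) * X (Fin.natAdd h c))) = 0 := by
      intro W hW
      have e := congr_fun h0 ⟨W, hW⟩
      change ∑ V : PT, c V * ℰ V ⟨W, hW⟩ = 0 at e
      have hsum : ∑ V ∈ PT, cV V *
          coeff (∑ a ∈ (∅ : Finset (Fin h)), Finsupp.single (Fin.castAdd h a) 1 +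
              ∑ c ∈ W, Finsupp.single (Fin.natAdd h c) 1)
            (∏ V' ∈ PT.erase V, (C 1 + ∑ a, C ((fun (_ : Fin h) (_ : Finset (Fin h)) => (0 : ℂ)) a V') *
              X (Fin.castAdd h a) + ∑ c, C (if c ∈ V' then (1 : ℂ) else 0) * X (Fin.natAdd h c))) =
          ∑ V : PT, c V * ℰ V ⟨W, hW⟩ := by
        rw [← Finset.sum_coe_sort PT]
        refine Finset.sum_congr rfl fun V _ => ?_
        simp only [cV, dif_pos V.2, hℰ, Matrix.of_apply]
      rw [hsum]
      exact e
    have hz := leaveOneOut_independent_of_downClosed PT (by rw [hPT]; exact hDD) cV hcV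
    funext V
    have := hz V V.2
    simp only [cV, dif_pos V.2] at this
    simpa using this
  have hsurj : Function.Surjective ℰ.vecMul :=
    Matrix.vecMul_surjective_iff_isUnit.mpr (Matrix.vecMul_injective_iff_isUnit.mp hinj)
  -- Step 2: the `x`-coefficients: row `{a}` (if `u i = {a}`) is sent to the indicator of column `w i`
  choose cvec hcvec using fun i : Fin r => hsurj (fun W : PT => if (W : Finset (Fin h)) = w i then (1 : ℂ) else 0)
  obtain ⟨κ, hκ⟩ : ∃ κ : Fin h → Finset (Fin h) → ℂ,
      ∀ i a, u i = {a} → ∀ V (hV : V ∈ PT), κ a V = cvec i ⟨V, hV⟩ := by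
    refine ⟨fun a V => if hx : ∃ i, u i = {a} then
      (if hV : V ∈ PT then cvec (Classical.choose hx) ⟨V, hV⟩ else 0) else 0, ?_⟩
    intro i a hia V hV
    have hx : ∃ i, u i = {a} := ⟨i, hia⟩
    have hi : Classical.choose hx = i := hu ((Classical.choose_spec hx).trans hia.symm)
    simp only [dif_pos hx, dif_pos hV, hi]
  -- Step 3: the forms and their embedding into `Fin (h + h)`
  obtain ⟨ℓ, hℓdeg, hℓprod⟩ := exists_forms_of_card_le PT (by rw [hPT]; exact hcard)
    (fun V => C 1 + ∑ a, C (κ a V) * X (Fin.castAdd h a) +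
      ∑ c, C (if c ∈ V then (1 : ℂ) else 0) * X (Fin.natAdd h c))
    (fun V _ => by
      have e : (C 1 + ∑ a, C (κ a V) * X (Fin.castAdd h a) +
          ∑ c, C (if c ∈ V then (1 : ℂ) else 0) * X (Fin.natAdd h c) : MvPolynomial (Fin (h + h)) ℂ) =
          C 1 + ∑ v : Fin (h + h), C (Fin.append (fun a => κ a V)
            (fun c => if c ∈ V then (1 : ℂ) else 0) v) * X v := by
        rw [Fin.sum_univ_add]
        simp only [Fin.append_left, Fin.append_right, add_assoc]
      rw [e]
      exact totalDegree_affine_le _ _)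
  refine ⟨ℓ, hℓdeg, ?_⟩
  rw [hℓprod]
  -- Step 4: the entries of the partition minor
  set bW : Finset (Fin h) → ℂ := fun W' =>
    coeff (∑ a ∈ (∅ : Finset (Fin h)), Finsupp.single (Fin.castAdd h a) 1 +
        ∑ c ∈ W', Finsupp.single (Fin.natAdd h c) 1)
      (∏ V ∈ PT, (C 1 + ∑ a, C (κ a V) * X (Fin.castAdd h a) +
        ∑ c, C (if c ∈ V then (1 : ℂ) else 0) * X (Fin.natAdd h c))) with hbW
  have hentry_single : ∀ i j a, u i = {a} →
      coeff (∑ a' ∈ u i, Finsupp.single (Fin.castAdd h a') 1 +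
          ∑ c ∈ w j, Finsupp.single (Fin.natAdd h c) 1)
        (∏ V ∈ PT, (C 1 + ∑ a, C (κ a V) * X (Fin.castAdd h a) +
          ∑ c, C (if c ∈ V then (1 : ℂ) else 0) * X (Fin.natAdd h c))) =
        if i = j then 1 else 0 := by
    intro i j a hia
    rw [hia, coeff_single_prod, ← Finset.sum_coe_sort PT]
    have hsum : ∑ V : PT, κ a (V : Finset (Fin h)) *
        coeff (∑ a' ∈ (∅ : Finset (Fin h)), Finsupp.single (Fin.castAdd h a') 1 +
            ∑ c ∈ w j, Finsupp.single (Fin.natAdd h c) 1)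
          (∏ V' ∈ PT.erase (V : Finset (Fin h)), (C 1 + ∑ a, C (κ a V') * X (Fin.castAdd h a) +
            ∑ c, C (if c ∈ V' then (1 : ℂ) else 0) * X (Fin.natAdd h c))) =
        ∑ V : PT, cvec i V * ℰ V ⟨w j, hwP j⟩ := by
      refine Finset.sum_congr rfl fun V _ => ?_
      rw [hκ i a hia V V.2, coeff_empty_prod_eq κ (fun _ _ => (0 : ℂ)) (PT.erase V) (w j)]
      simp only [hℰ, Matrix.of_apply]
    have e := congr_fun (hcvec i) ⟨w j, hwP j⟩
    change ∑ V : PT, cvec i V * ℰ V ⟨w j, hwP j⟩ = (if w j = w i then (1 : ℂ) else 0) at e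
    rw [hsum, e]
    by_cases hij : i = j
    · subst hij; simp
    · rw [if_neg (fun e' => hij (hw e'.symm)), if_neg hij]
  -- Step 5: the determinant
  by_cases h0 : ∃ i₀, u i₀ = ∅
  · obtain ⟨i₀, hi₀⟩ := h0
    have hdet : (Matrix.of fun i j : Fin r => MvPolynomial.coeff
        (∑ a ∈ u i, Finsupp.single (Fin.castAdd h a) 1 +
          ∑ c ∈ w j, Finsupp.single (Fin.natAdd h c) 1)
        (∏ V ∈ PT, (C 1 + ∑ a, C (κ a V) * X (Fin.castAdd h a) +
          ∑ c, C (if c ∈ V then (1 : ℂ) else 0) * X (Fin.natAdd h c)))).det = bW (w i₀) := by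
      refine det_one_updateRow _ i₀ (fun j => bW (w j)) fun i j => ?_
      rw [Matrix.of_apply]
      by_cases hi : i = i₀
      · subst hi
        rw [if_pos rfl, hi₀]
      · rw [if_neg hi]
        have hne : u i ≠ ∅ := fun e => hi (hu (e.trans hi₀.symm))
        have hcard : (u i).card = 1 := by
          have := hu1 i
          have hpos := Finset.card_pos.mpr (Finset.nonempty_iff_ne_empty.mpr hne)
          omega
        obtain ⟨a, ha⟩ := Finset.card_eq_one.mp hcard
        exact hentry_single i j a ha
    rw [hdet]
    obtain ⟨n, hn, hn1⟩ := coeff_empty_prod_nat κ PT (w i₀)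
    have h1 : 1 ≤ n := hn1 fun c hc =>
      hDD (w i₀) (hwT i₀) {c} (Finset.singleton_subset_iff.mpr hc)
    simp only [hbW]
    rw [hn]
    exact_mod_cast (by omega : n ≠ 0)
  · have hdet : (Matrix.of fun i j : Fin r => MvPolynomial.coeff
        (∑ a ∈ u i, Finsupp.single (Fin.castAdd h a) 1 +
          ∑ c ∈ w j, Finsupp.single (Fin.natAdd h c) 1)
        (∏ V ∈ PT, (C 1 + ∑ a, C (κ a V) * X (Fin.castAdd h a) +
          ∑ c, C (if c ∈ V then (1 : ℂ) else 0) * X (Fin.natAdd h c)))) = 1 := by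
      ext i j
      rw [Matrix.of_apply, Matrix.one_apply]
      have hne : u i ≠ ∅ := fun e => h0 ⟨i, e⟩
      have hcard : (u i).card = 1 := by
        have := hu1 i
        have hpos := Finset.card_pos.mpr (Finset.nonempty_iff_ne_empty.mpr hne)
        omega
      obtain ⟨a, ha⟩ := Finset.card_eq_one.mp hcard
      exact hentry_single i j a ha
    rw [hdet, Matrix.det_one]
    exact one_ne_zero

/-- **Sub-cube columns, every height** (the TNS-capacity regime): rows of size `≤ 1`, columns
inside a cube `2^T` with `2^{|T|} ≤ h + h` — ONE explicit product of `h + h` affine forms makes the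
partition minor nonsingular.  Contains every layout of the capacity counterexamples to TNS (rows
`∅` + singletons, columns all of `2^T`, `2^{|T|} = h + 1`). -/
theorem chowHits_firstOrderRows_subcubeColumns (h : ℕ) (T : Finset (Fin h))
    (hT : 2 ^ T.card ≤ h + h) (r : ℕ) (u w : Fin r → Finset (Fin h))
    (hu : Function.Injective u) (hw : Function.Injective w)
    (hu1 : ∀ i, (u i).card ≤ 1) (hwT : ∀ j, w j ⊆ T) :
    ∃ ℓ : Fin (h + h) → MvPolynomial (Fin (h + h)) ℂ, (∀ k, (ℓ k).totalDegree ≤ 1) ∧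
      (Matrix.of fun i j : Fin r => MvPolynomial.coeff
        (∑ a ∈ u i, Finsupp.single (Fin.castAdd h a) 1 +
          ∑ c ∈ w j, Finsupp.single (Fin.natAdd h c) 1) (∏ k, ℓ k)).det ≠ 0 :=
  chowHits_firstOrderRows_of_downClosed h T.powerset
    (fun W hW U hU => Finset.mem_powerset.mpr (hU.trans (Finset.mem_powerset.mp hW)))
    (by rw [Finset.card_powerset]; exact hT) r u w hu hw hu1
    (fun j => Finset.mem_powerset.mpr (hwT j))

/-- **Down-closed column families (simplicial complexes), every height `h ≥ 1`**: rows of size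
`≤ 1` and ANY injective column family that is closed under taking subsets — no restriction on the
size of the sets — ONE explicit product of `h + h` affine forms makes the partition minor
nonsingular (the `≤ h + 1` columns themselves index the indicator forms). -/
theorem chowHits_firstOrderRows_downClosedColumns (h : ℕ) (hh : 1 ≤ h) (r : ℕ)
    (u w : Fin r → Finset (Fin h)) (hu : Function.Injective u) (hw : Function.Injective w)
    (hu1 : ∀ i, (u i).card ≤ 1) (hdown : ∀ j (U : Finset (Fin h)), U ⊆ w j → ∃ j', w j' = U) :
    ∃ ℓ : Fin (h + h) → MvPolynomial (Fin (h + h)) ℂ, (∀ k, (ℓ k).totalDegree ≤ 1) ∧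
      (Matrix.of fun i j : Fin r => MvPolynomial.coeff
        (∑ a ∈ u i, Finsupp.single (Fin.castAdd h a) 1 +
          ∑ c ∈ w j, Finsupp.single (Fin.natAdd h c) 1) (∏ k, ℓ k)).det ≠ 0 := by
  classical
  refine chowHits_firstOrderRows_of_downClosed h (Finset.univ.image w) ?_ ?_ r u w hu hw hu1
    (fun j => Finset.mem_image_of_mem w (Finset.mem_univ j))
  · intro W hW U hU
    obtain ⟨j, -, rfl⟩ := Finset.mem_image.mp hW
    obtain ⟨j', hj'⟩ := hdown j U hU
    exact Finset.mem_image.mpr ⟨j', Finset.mem_univ _, hj'⟩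
  · -- `r ≤ h + 1 ≤ h + h`: the rows are distinct subsets of size `≤ 1`
    have hrow : (Finset.univ.image u) ⊆ insert ∅ ((Finset.univ : Finset (Fin h)).image fun a => {a}) := by
      intro S hS
      obtain ⟨i, -, rfl⟩ := Finset.mem_image.mp hS
      rcases Nat.lt_or_ge (u i).card 1 with h0 | h1
      · exact Finset.mem_insert.mpr (Or.inl (Finset.card_eq_zero.mp (by omega)))
      · obtain ⟨a, ha⟩ := Finset.card_eq_one.mp (le_antisymm (hu1 i) h1)
        exact Finset.mem_insert.mpr (Or.inr (Finset.mem_image.mpr ⟨a, Finset.mem_univ _, ha.symm⟩))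
    have hr : r ≤ h + 1 := by
      have e1 : (Finset.univ.image u).card = r := by
        rw [Finset.card_image_of_injective _ hu, Finset.card_univ, Fintype.card_fin]
      have e2 := (Finset.card_le_card hrow).trans (Finset.card_insert_le _ _)
      have e3 : ((Finset.univ : Finset (Fin h)).image fun a => ({a} : Finset (Fin h))).card ≤ h :=
        Finset.card_image_le.trans (by rw [Finset.card_univ, Fintype.card_fin])
      omega
    calc (Finset.univ.image w).card ≤ (Finset.univ : Finset (Fin r)).card := Finset.card_image_le
      _ = r := by rw [Finset.card_univ, Fintype.card_fin]
      _ ≤ h + h := by omega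


/-- **Small down-closure, every height**: rows of size `≤ 1` and any injective column family whose
DOWN-CLOSURE `⋃_j 2^{w j}` has at most `h + h` sets — ONE explicit product of `h + h` affine forms
makes the partition minor nonsingular (both previous corollaries are instances). -/
theorem chowHits_firstOrderRows_smallShadow (h : ℕ) (r : ℕ) (u w : Fin r → Finset (Fin h))
    (hu : Function.Injective u) (hw : Function.Injective w) (hu1 : ∀ i, (u i).card ≤ 1)
    (hshadow : ((Finset.univ : Finset (Fin r)).biUnion fun j => (w j).powerset).card ≤ h + h) :
    ∃ ℓ : Fin (h + h) → MvPolynomial (Fin (h + h)) ℂ, (∀ k, (ℓ k).totalDegree ≤ 1) ∧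
      (Matrix.of fun i j : Fin r => MvPolynomial.coeff
        (∑ a ∈ u i, Finsupp.single (Fin.castAdd h a) 1 +
          ∑ c ∈ w j, Finsupp.single (Fin.natAdd h c) 1) (∏ k, ℓ k)).det ≠ 0 := by
  classical
  refine chowHits_firstOrderRows_of_downClosed h
    ((Finset.univ : Finset (Fin r)).biUnion fun j => (w j).powerset) ?_ hshadow r u w hu hw hu1
    (fun j => Finset.mem_biUnion.mpr ⟨j, Finset.mem_univ _, Finset.mem_powerset_self _⟩)
  intro W hW U hU
  obtain ⟨j, -, hj⟩ := Finset.mem_biUnion.mp hW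
  exact Finset.mem_biUnion.mpr ⟨j, Finset.mem_univ _,
    Finset.mem_powerset.mpr (hU.trans (Finset.mem_powerset.mp hj))⟩

end Summit.ValiantsHypothesis.ValiantsHypothesis.Theorems.BarrierLever.ChowSubcube
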